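import Literature.NumberTheory.Automorphic.UnitaryCompactElementVertexLattice          -- ★ p843366 A-p03 (g25) I-5a FILE B `UnitaryGroup.exists_eq_mul_mul_inv_or_of_trace_mem`
import Literature.NumberTheory.Automorphic.UnitaryCompactElementVertexLatticeRamified  -- ★ p843555 A-p03 (g26) I-5a-ram FILE D `…exists_eq_mul_mul_inv_or_of_trace_mem_of_ramified` (ED. 2)
import Literature.NumberTheory.Automorphic.LocalUnitaryIntegralLevel                   -- ★ `cmLocalIntegralLevel`, `mem_localIntegralLevel_iff_of_smul_eq`, `isCompact_isOpen_cmLocalIntegralLevel`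
import Literature.NumberTheory.Automorphic.UnitaryGroupArithmeticLevels                -- ★ `ShimuraVarieties.unitaryGroup_eq_unitaryGroupOfForm`
import Literature.NumberTheory.Automorphic.UnitaryGroupOfFormAdelicTopology            -- ★ `isClosed_unitaryGroupOfForm`
import Literature.NumberTheory.Automorphic.ReductiveGroupData                          -- ★ `isOpen_glInt`, `isCompact_glInt`
import Literature.NumberTheory.Automorphic.OrbitalIntegralDoubleCosetUnfolding         -- ★ `conj_mem_iff_smul_mk_eq`
import Literature.NumberTheory.GaloisRepresentations.CompletionCompositumUnitBall      -- ★ `SemiLocal.valuation_le_one_iff_valued_le_one`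
import Literature.NumberTheory.Automorphic.AdelicUnitaryGroupDatum                     -- ★ `cmDatum`
import HarnessLib

/-!
# The VERTEX COVER of the trace-integral locus of `U(Φ₂)(L⁺_v)` at an inert place, in the `cmDatum` currency (road «R1LL-tree», brick I-7b (iii))

Topic `NumberTheory/Rogawski1990`; namespace `Literature.NumberTheory.Rogawski1990`.  THEOREMS ONLY (no definition, no instance, no notation, no named fact,
no `sorry`); kernel lane.  Cell `pub/hodgecm-mathlib`, crux H413 = `stmt-HodgeConjecture-24833`, road «R1LL-tree» = in-house pay-down of ★
`RankOneUnstableTransferNonsplitCME` at an INERT place (architect A-p16 (g27), RULINGS A-2, A-12 (a), A-14 (e)); this file discharges the binder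
`hcov` of ★ I-5c `exists_sum_integral_conj_eq_of_vertexCover` (p843139) and of ★ F0P3-p01 (g13)'s assembly `exists_pieces_integral_conj_sub_map_eq_sum` (p843367)
from A-p03 (g25)'s one-place theorem ★ `UnitaryGroup.exists_eq_mul_mul_inv_or_of_trace_mem` (p843366), by TRANSPORT along the one-place model
★ `localNonsplitEquiv : U(Φ₂)(L⁺_v) ≃ₜ* U(σ_w, (Φ₂)_w)(L_w)`.
HONEST LABEL: HC_CM is proved only modulo the 2 remaining named inputs (hLiu418, h413) until rung 0 closes; nothing printed is asserted here.

THE MATHEMATICS.  `v` a finite place of `L⁺` NON-SPLIT (`c • w = w`) and UNRAMIFIED in the CM field `L`, `H₂ := U(Φ₂)(L⁺_v)` (carrier `(cmDatum L 2 Φ₂).Local v`),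
`e₂ : H₂ ≃ₜ* U := U(σ_w, (Φ₂)_w)(L_w) ≤ GL₂(L_w)` the one-place model.  The two VERTEX STABILISERS of the Bruhat–Tits tree of `U` are
`K⁰ := U ∩ GL₂(𝒪_w)` (self-dual vertex) and `K¹ := U ∩ D_ϖ GL₂(𝒪_w) D_ϖ⁻¹`, `D_ϖ = diag(1, ϖ_w)` (`ϖ`-modular vertex); A-p03's theorem says every `γ ∈ U` with
`tr γ ∈ 𝒪_w` is `U`-conjugate into `K⁰` or into `K¹` [Serre, Trees, Ch. II §1.3; Kottwitz 1988 §2; Rogawski 1990 Lemma 4.9.3].  Pulling back,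
`K₂ 0 := e₂⁻¹ K⁰ = U(Φ₂)(𝒪_v)` (★ `cmLocalIntegralLevel`, ★ `mem_localIntegralLevel_iff_of_smul_eq`) and `K₂ 1 := e₂⁻¹ K¹` are compact open subgroups of `H₂`
and every `g₂ ∈ H₂` with `v_w(tr g₂) ≤ 1` satisfies `y⁻¹ g₂ y ∈ K₂ ε` for some `ε ∈ {0,1}`, `y ∈ H₂` — the literal binder `hcov`.

* §1 (generic) `finite_fixedBy_quotient_of_isCompact_setOf_conj_mem` — `Fix_γ(G⧸K)` is finite when `{h | hγh⁻¹ ∈ K}` is compact and `K` open (the `hfin` of the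
  per-piece unfolding, fed by ★ F0P3-p01 `isCompact_setOf_conj_mem_of_mem_centralizer`); `isOpen_coe_comap_of_continuous`, `isCompact_coe_comap_homeomorph`.
* §2 (CM) `trace_coe_localNonsplitEquiv` (`tr (e₂ g) = (tr g)_w`), `isCompact_isOpen_conjGlInt_subgroupOf_unitary` (`K¹` compact open in `U`),
  **`exists_vertexCover`** — the package `∃ K₂ : Fin 2 → Subgroup H₂` with `K₂ 0 = U(Φ₂)(𝒪_v)`, the two membership dictionaries through `e₂`, `hK₂o`, `hK₂c`, `hcov`.
* §3 (ED. 2, TAMELY RAMIFIED `w`) **`exists_vertexCover_of_ramified`** — the same package at a ramified non-split `w` (`σ_w η = −η`, `K₂ 0` = EDGE stabiliser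
  `U(Φ₂)(𝒪_v)`, `K₂ 1 = e₂⁻¹(U ∩ D_η GL₂(𝒪_w) D_η⁻¹)` = VERTEX stabiliser), transported from ★ A-p03 (g26) `exists_eq_mul_mul_inv_or_of_trace_mem_of_ramified` (p843555).

## References
* [Serre1980Trees] J.-P. Serre, *Trees* (1980), Ch. II §1.3.
* [Kottwitz1988] R. E. Kottwitz, *Tamagawa numbers*, Ann. of Math. 127 (1988), §2.
* [Rogawski1990] J. D. Rogawski, *Automorphic Representations of Unitary Groups in Three Variables* (1990), §4.9 Lemma 4.9.3 p. 56; §3.5 p. 29.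
* [PlatonovRapinchuk1994] V. Platonov, A. Rapinchuk, *Algebraic Groups and Number Theory* (1994), §5.1, §3.3.
* [DeitmarEchterhoff2014] A. Deitmar, S. Echterhoff, *Principles of Harmonic Analysis*, 2nd ed. (2014), Lemma 9.3.3.
-/

set_option autoImplicit false

noncomputable section

open Topology Set Function NumberField IsDedekindDomain Matrix MulAction
open scoped MatrixGroups

/-! ## §1 Generic: finiteness of fixed points from properness; topology of pulled-back subgroups -/

namespace Literature.GroupTheory

variable {G G' : Type*} [Group G] [TopologicalSpace G] [Group G'] [TopologicalSpace G']

/-- **`Fix_γ(G ⧸ K)` is finite** when `K` is an open subgroup and `{h | h γ h⁻¹ ∈ K}` is compact: `Fix_γ` is the image of that compact set under the continuous map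
`h ↦ h⁻¹K` into the DISCRETE space `G ⧸ K`. [cite: DeitmarEchterhoff2014, Lemma 9.3.3] -/
theorem finite_fixedBy_quotient_of_isCompact_setOf_conj_mem [IsTopologicalGroup G] (K : Subgroup G) (hK : IsOpen (K : Set G)) (γ : G)
    (hc : IsCompact {h : G | h * γ * h⁻¹ ∈ K}) : (fixedBy (G ⧸ K) γ).Finite := by
  haveI : DiscreteTopology (G ⧸ K) := QuotientGroup.discreteTopology hK
  have hsub : fixedBy (G ⧸ K) γ ⊆ (fun h : G => ((h⁻¹ : G) : G ⧸ K)) '' {h : G | h * γ * h⁻¹ ∈ K} := by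
    intro q hq
    induction q using QuotientGroup.induction_on with
    | H x =>
      refine ⟨x⁻¹, ?_, by simp only [inv_inv]⟩
      rw [mem_setOf_eq, Literature.NumberTheory.Automorphic.conj_mem_iff_smul_mk_eq, inv_inv]
      exact hq
  exact ((hc.image (QuotientGroup.continuous_mk.comp continuous_inv)).finite_of_discrete).subset hsub

/-- The pull-back of an open subgroup along a continuous hom is open. [cite: PlatonovRapinchuk1994, §3.3] -/
theorem isOpen_coe_comap_of_continuous (f : G →* G') (hf : Continuous f) (K' : Subgroup G') (hK' : IsOpen (K' : Set G')) :
    IsOpen ((K'.comap f : Subgroup G) : Set G) := by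
  rw [Subgroup.coe_comap]; exact hK'.preimage hf

/-- The pull-back of a compact subgroup along an isomorphism of topological groups is compact. [cite: PlatonovRapinchuk1994, §3.3] -/
theorem isCompact_coe_comap_continuousMulEquiv [IsTopologicalGroup G'] (e : G ≃ₜ* G') (K' : Subgroup G') (hK' : IsCompact (K' : Set G')) :
    IsCompact ((K'.comap e.toMulEquiv.toMonoidHom : Subgroup G) : Set G) := by
  rw [Subgroup.coe_comap]
  exact e.toHomeomorph.isCompact_preimage.2 hK'

end Literature.GroupTheory

/-! ## §2 CM: the vertex cover of the trace-integral locus of `U(Φ₂)(L⁺_v)` -/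

namespace Literature.NumberTheory.Rogawski1990

open Literature.NumberTheory.Automorphic Literature.NumberTheory.Automorphic.UnitaryGroup Literature.NumberTheory.GaloisRepresentations

variable (L : Type) [Field L] [NumberField L] [IsCMField L] (v : HeightOneSpectrum (𝓞 ↥(maximalRealSubfield L)))
  (w : PlacesOver L v) (hw : IsCMField.complexConj L • w.1 = w.1)

/-- **`tr (e₂ g) = (tr g)_w`**: the one-place model is entrywise evaluation at `w` (★ `coe_localNonsplitEquiv_apply`, `rfl`). [cite: PlatonovRapinchuk1994, §5.1] -/
theorem trace_coe_localNonsplitEquiv {N : ℕ} (J : Matrix (Fin N) (Fin N) L) (g : (cmDatum L N J).Local v) :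
    (((localNonsplitEquiv (IsCMField.complexConj L) J (IsCMField.complexConj_ne_one L) w hw g :
        ↥(unitaryGroupOfForm (galAdicCompletionMap (L := L) (IsCMField.complexConj L) hw) (placeForm J w.1))) :
          GL (Fin N) (w.1.adicCompletion L)) : Matrix (Fin N) (Fin N) (w.1.adicCompletion L)).trace =
      ((g.val.val : Matrix (Fin N) (Fin N) (LocalRing L v)).trace) w := by
  rw [coe_localNonsplitEquiv_apply]
  simp only [Matrix.trace, Matrix.diag, Matrix.map_apply, Finset.sum_apply, Pi.evalRingHom_apply]

/-- **`K¹ = U ∩ D GL₂(𝒪_w) D⁻¹` is compact and open in `U`** for any `D ∈ GL_N(L_w)` (`GL_N(𝒪_w)` compact open ★ `isCompact_glInt` ∕ ★ `isOpen_glInt`, conjugation a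
homeomorphism, `U` closed ★ `isClosed_unitaryGroupOfForm`). [cite: PlatonovRapinchuk1994, §3.3] [cite: Serre1980Trees, Ch. II §1.3] -/
theorem isCompact_isOpen_conjGlInt_subgroupOf_unitary {N : ℕ} (J : Matrix (Fin N) (Fin N) (w.1.adicCompletion L)) (D : GL (Fin N) (w.1.adicCompletion L)) :
    IsCompact ((((glInt N (w.1.adicCompletion L)).map (MulAut.conj D).toMonoidHom).subgroupOf
        (unitaryGroupOfForm (galAdicCompletionMap (L := L) (IsCMField.complexConj L) hw) J) :
          Subgroup ↥(unitaryGroupOfForm (galAdicCompletionMap (L := L) (IsCMField.complexConj L) hw) J)) :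
        Set ↥(unitaryGroupOfForm (galAdicCompletionMap (L := L) (IsCMField.complexConj L) hw) J)) ∧
      IsOpen ((((glInt N (w.1.adicCompletion L)).map (MulAut.conj D).toMonoidHom).subgroupOf
        (unitaryGroupOfForm (galAdicCompletionMap (L := L) (IsCMField.complexConj L) hw) J) :
          Subgroup ↥(unitaryGroupOfForm (galAdicCompletionMap (L := L) (IsCMField.complexConj L) hw) J)) :
        Set ↥(unitaryGroupOfForm (galAdicCompletionMap (L := L) (IsCMField.complexConj L) hw) J)) := by
  -- the conjugate `D GL_N(𝒪) D⁻¹` as the image under the homeomorphism `g ↦ D g D⁻¹`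
  have himg : (((glInt N (w.1.adicCompletion L)).map (MulAut.conj D).toMonoidHom : Subgroup (GL (Fin N) (w.1.adicCompletion L))) :
      Set (GL (Fin N) (w.1.adicCompletion L))) =
      ((Homeomorph.mulLeft D).trans (Homeomorph.mulRight D⁻¹)) '' (glInt N (w.1.adicCompletion L) : Set (GL (Fin N) (w.1.adicCompletion L))) := by
    rw [Subgroup.coe_map]; rfl
  have hc : IsCompact (((glInt N (w.1.adicCompletion L)).map (MulAut.conj D).toMonoidHom : Subgroup (GL (Fin N) (w.1.adicCompletion L))) :
      Set (GL (Fin N) (w.1.adicCompletion L))) := by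
    rw [himg]; exact (isCompact_glInt N (w.1.adicCompletion L)).image (Homeomorph.continuous _)
  have ho : IsOpen (((glInt N (w.1.adicCompletion L)).map (MulAut.conj D).toMonoidHom : Subgroup (GL (Fin N) (w.1.adicCompletion L))) :
      Set (GL (Fin N) (w.1.adicCompletion L))) := by
    rw [himg]; exact (Homeomorph.isOpenMap _) _ (isOpen_glInt N (w.1.adicCompletion L))
  have hU : IsClosed ((unitaryGroupOfForm (galAdicCompletionMap (L := L) (IsCMField.complexConj L) hw) J : Subgroup (GL (Fin N) (w.1.adicCompletion L))) :
      Set (GL (Fin N) (w.1.adicCompletion L))) :=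
    isClosed_unitaryGroupOfForm (continuous_galAdicCompletionMap (L := L) (IsCMField.complexConj L) hw) J
  refine ⟨?_, ?_⟩
  · rw [Subgroup.coe_subgroupOf]; exact hU.isClosedEmbedding_subtypeVal.isCompact_preimage hc
  · rw [Subgroup.coe_subgroupOf]; exact ho.preimage continuous_subtype_val

/-- **THE VERTEX COVER (binder `hcov` of ★ I-5c ∕ ★ F0P3-p01's assembly), `cmDatum` currency.**  At `v` non-split and unramified in `L` there are two compact open
subgroups `K₂ 0, K₂ 1 ≤ U(Φ₂)(L⁺_v)` — `K₂ 0 = U(Φ₂)(𝒪_v)` (★ `cmLocalIntegralLevel`; in the one-place model `GL₂(𝒪_w) ∩ U`) and `K₂ 1 = e₂⁻¹(U ∩ D_ϖ GL₂(𝒪_w) D_ϖ⁻¹)`,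
`D_ϖ = diag(1, ϖ_w)` (the `ϖ`-modular vertex) — such that every `g₂` with `v_w(tr g₂) ≤ 1` is conjugate INTO one of them: `y⁻¹ g₂ y ∈ K₂ ε`.  Transport of ★
A-p03 `exists_eq_mul_mul_inv_or_of_trace_mem` along ★ `localNonsplitEquiv` (+ ★ `unitaryGroup_eq_unitaryGroupOfForm` for the two renderings of `U`).
[cite: Serre1980Trees, Ch. II §1.3] [cite: Kottwitz1988, §2] [cite: Rogawski1990, §4.9 Lemma 4.9.3 p. 56] [cite: PlatonovRapinchuk1994, §5.1] -/
theorem exists_vertexCover (hunr : Algebra.IsUnramifiedIn (𝓞 L) v.asIdeal) :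
    ∃ K₂ : Fin 2 → Subgroup ((cmDatum L 2 (Matrix.of fun i j : Fin 2 => if i.val + j.val + 1 = 2 then (1 : L) else 0)).Local v),
      K₂ 0 = cmLocalIntegralLevel L 2 (Matrix.of fun i j : Fin 2 => if i.val + j.val + 1 = 2 then (1 : L) else 0) v ∧
      (∀ g, g ∈ K₂ 0 ↔
        ((localNonsplitEquiv (IsCMField.complexConj L) (Matrix.of fun i j : Fin 2 => if i.val + j.val + 1 = 2 then (1 : L) else 0)
            (IsCMField.complexConj_ne_one L) w hw g :
            ↥(unitaryGroupOfForm (galAdicCompletionMap (L := L) (IsCMField.complexConj L) hw)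
              (placeForm (Matrix.of fun i j : Fin 2 => if i.val + j.val + 1 = 2 then (1 : L) else 0) w.1))) :
          GL (Fin 2) (w.1.adicCompletion L)) ∈ glInt 2 (w.1.adicCompletion L)) ∧
      (∀ g, g ∈ K₂ 1 ↔
        ((localNonsplitEquiv (IsCMField.complexConj L) (Matrix.of fun i j : Fin 2 => if i.val + j.val + 1 = 2 then (1 : L) else 0)
            (IsCMField.complexConj_ne_one L) w hw g :
            ↥(unitaryGroupOfForm (galAdicCompletionMap (L := L) (IsCMField.complexConj L) hw)
              (placeForm (Matrix.of fun i j : Fin 2 => if i.val + j.val + 1 = 2 then (1 : L) else 0) w.1))) :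
          GL (Fin 2) (w.1.adicCompletion L)) ∈
          (glInt 2 (w.1.adicCompletion L)).map (MulAut.conj (glDiagonal 2 (w.1.adicCompletion L)
            ![1, Units.mk0 (toPlace v w (HeckeCharacter.uniformizer ↥(maximalRealSubfield L) v : v.adicCompletion ↥(maximalRealSubfield L)))
              (toPlace_uniformizer_ne_zero L v w hunr)])).toMonoidHom) ∧
      (∀ ε, IsOpen (K₂ ε : Set ((cmDatum L 2 (Matrix.of fun i j : Fin 2 => if i.val + j.val + 1 = 2 then (1 : L) else 0)).Local v))) ∧
      (∀ ε, IsCompact (K₂ ε : Set ((cmDatum L 2 (Matrix.of fun i j : Fin 2 => if i.val + j.val + 1 = 2 then (1 : L) else 0)).Local v))) ∧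
      ∀ g₂ : (cmDatum L 2 (Matrix.of fun i j : Fin 2 => if i.val + j.val + 1 = 2 then (1 : L) else 0)).Local v,
        Valued.v (((g₂.val.val : Matrix (Fin 2) (Fin 2) (LocalRing L v)).trace) w) ≤ 1 →
          ∃ (ε : Fin 2) (y : (cmDatum L 2 (Matrix.of fun i j : Fin 2 => if i.val + j.val + 1 = 2 then (1 : L) else 0)).Local v),
            y⁻¹ * g₂ * y ∈ K₂ ε := by
  -- the one-place model, re-typed on the `cmDatum` carrier (definitionally the subgroup carrier, ★ `cmDatum_Local` `rfl`) so that all algebra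
  -- below runs in ONE rendering of the group structure
  obtain ⟨E₂, hE₂⟩ : ∃ E₂ : (cmDatum L 2 (Matrix.of fun i j : Fin 2 => if i.val + j.val + 1 = 2 then (1 : L) else 0)).Local v ≃ₜ* ↥(unitaryGroupOfForm (galAdicCompletionMap (L := L) (IsCMField.complexConj L) hw) (placeForm (Matrix.of fun i j : Fin 2 => if i.val + j.val + 1 = 2 then (1 : L) else 0) w.1)),
      ∀ g, ((E₂ g : ↥(unitaryGroupOfForm (galAdicCompletionMap (L := L) (IsCMField.complexConj L) hw) (placeForm (Matrix.of fun i j : Fin 2 => if i.val + j.val + 1 = 2 then (1 : L) else 0) w.1))) : GL (Fin 2) (w.1.adicCompletion L)) = (((localNonsplitEquiv (IsCMField.complexConj L) (Matrix.of fun i j : Fin 2 => if i.val + j.val + 1 = 2 then (1 : L) else 0) (IsCMField.complexConj_ne_one L) w hw) g : ↥(unitaryGroupOfForm (galAdicCompletionMap (L := L) (IsCMField.complexConj L) hw) (placeForm (Matrix.of fun i j : Fin 2 => if i.val + j.val + 1 = 2 then (1 : L) else 0) w.1))) : GL (Fin 2) (w.1.adicCompletion L)) :=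
    ⟨(localNonsplitEquiv (IsCMField.complexConj L) (Matrix.of fun i j : Fin 2 => if i.val + j.val + 1 = 2 then (1 : L) else 0) (IsCMField.complexConj_ne_one L) w hw), fun _ => rfl⟩
  have hUG : Literature.AlgebraicGeometry.ShimuraVarieties.unitaryGroup (galAdicCompletionMap (L := L) (IsCMField.complexConj L) hw) (placeForm (Matrix.of fun i j : Fin 2 => if i.val + j.val + 1 = 2 then (1 : L) else 0) w.1) = (unitaryGroupOfForm (galAdicCompletionMap (L := L) (IsCMField.complexConj L) hw) (placeForm (Matrix.of fun i j : Fin 2 => if i.val + j.val + 1 = 2 then (1 : L) else 0) w.1)) :=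
    Literature.AlgebraicGeometry.ShimuraVarieties.unitaryGroup_eq_unitaryGroupOfForm _ _
  have hK1 := isCompact_isOpen_conjGlInt_subgroupOf_unitary L v w hw (placeForm (Matrix.of fun i j : Fin 2 => if i.val + j.val + 1 = 2 then (1 : L) else 0) w.1) (glDiagonal 2 (w.1.adicCompletion L) ![1, Units.mk0 (toPlace v w (HeckeCharacter.uniformizer ↥(maximalRealSubfield L) v : v.adicCompletion ↥(maximalRealSubfield L))) (toPlace_uniformizer_ne_zero L v w hunr)])
  -- the two pulled-back vertex stabilisers
  refine ⟨![cmLocalIntegralLevel L 2 (Matrix.of fun i j : Fin 2 => if i.val + j.val + 1 = 2 then (1 : L) else 0) v,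
      ((((glInt 2 (w.1.adicCompletion L)).map (MulAut.conj (glDiagonal 2 (w.1.adicCompletion L) ![1, Units.mk0 (toPlace v w (HeckeCharacter.uniformizer ↥(maximalRealSubfield L) v : v.adicCompletion ↥(maximalRealSubfield L))) (toPlace_uniformizer_ne_zero L v w hunr)])).toMonoidHom).subgroupOf (unitaryGroupOfForm (galAdicCompletionMap (L := L) (IsCMField.complexConj L) hw) (placeForm (Matrix.of fun i j : Fin 2 => if i.val + j.val + 1 = 2 then (1 : L) else 0) w.1))).comap E₂.toMulEquiv.toMonoidHom)],
    rfl, fun g => mem_localIntegralLevel_iff_of_smul_eq (IsCMField.complexConj L) 2 (Matrix.of fun i j : Fin 2 => if i.val + j.val + 1 = 2 then (1 : L) else 0) (IsCMField.complexConj_ne_one L) w hw g,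
    fun g => ?_, fun ε => ?_, fun ε => ?_, fun g₂ hg₂ => ?_⟩
  · -- membership in `K₂ 1`
    simp only [Matrix.cons_val_one, Matrix.cons_val_zero, Subgroup.mem_comap, Subgroup.mem_subgroupOf]
    rw [← hE₂ g]; rfl
  · -- open
    fin_cases ε
    · exact (isCompact_isOpen_cmLocalIntegralLevel L 2 (Matrix.of fun i j : Fin 2 => if i.val + j.val + 1 = 2 then (1 : L) else 0) v).2
    · exact Literature.GroupTheory.isOpen_coe_comap_of_continuous E₂.toMulEquiv.toMonoidHom E₂.continuous _ hK1.2
  · -- compact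
    fin_cases ε
    · exact (isCompact_isOpen_cmLocalIntegralLevel L 2 (Matrix.of fun i j : Fin 2 => if i.val + j.val + 1 = 2 then (1 : L) else 0) v).1
    · exact Literature.GroupTheory.isCompact_coe_comap_continuousMulEquiv E₂ _ hK1.1
  · -- the cover, transported from the one-place model
    have htr : ((((E₂ g₂ : ↥(unitaryGroupOfForm (galAdicCompletionMap (L := L) (IsCMField.complexConj L) hw) (placeForm (Matrix.of fun i j : Fin 2 => if i.val + j.val + 1 = 2 then (1 : L) else 0) w.1))) : GL (Fin 2) (w.1.adicCompletion L)) : Matrix (Fin 2) (Fin 2) (w.1.adicCompletion L))).trace ∈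
        (ValuativeRel.valuation (w.1.adicCompletion L)).integer := by
      rw [Valuation.mem_integer_iff, SemiLocal.valuation_le_one_iff_valued_le_one, hE₂, trace_coe_localNonsplitEquiv L v w hw _ g₂]
      exact hg₂
    -- A-p03's theorem in the rendering `ShimuraVarieties.unitaryGroup`
    obtain ⟨γ', hγ'⟩ : ∃ γ' : ↥(Literature.AlgebraicGeometry.ShimuraVarieties.unitaryGroup (galAdicCompletionMap (L := L) (IsCMField.complexConj L) hw) (placeForm (Matrix.of fun i j : Fin 2 => if i.val + j.val + 1 = 2 then (1 : L) else 0) w.1)),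
        (γ' : GL (Fin 2) (w.1.adicCompletion L)) = ((E₂ g₂ : ↥(unitaryGroupOfForm (galAdicCompletionMap (L := L) (IsCMField.complexConj L) hw) (placeForm (Matrix.of fun i j : Fin 2 => if i.val + j.val + 1 = 2 then (1 : L) else 0) w.1))) : GL (Fin 2) (w.1.adicCompletion L)) :=
      ⟨⟨((E₂ g₂ : ↥(unitaryGroupOfForm (galAdicCompletionMap (L := L) (IsCMField.complexConj L) hw) (placeForm (Matrix.of fun i j : Fin 2 => if i.val + j.val + 1 = 2 then (1 : L) else 0) w.1))) : GL (Fin 2) (w.1.adicCompletion L)), by rw [hUG]; exact (E₂ g₂).2⟩, rfl⟩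
    have key := exists_eq_mul_mul_inv_or_of_trace_mem L v w hw hunr γ' (by rw [hγ']; exact htr)
    -- a unitary `y'` there gives `y` here with `E₂ (y⁻¹ g₂ y) = y'⁻¹ γ' y' = k` on matrices
    have transport : ∀ (y' k : ↥(Literature.AlgebraicGeometry.ShimuraVarieties.unitaryGroup (galAdicCompletionMap (L := L) (IsCMField.complexConj L) hw) (placeForm (Matrix.of fun i j : Fin 2 => if i.val + j.val + 1 = 2 then (1 : L) else 0) w.1))),
        γ' = y' * k * y'⁻¹ → ∃ y : (cmDatum L 2 (Matrix.of fun i j : Fin 2 => if i.val + j.val + 1 = 2 then (1 : L) else 0)).Local v, ((E₂ (y⁻¹ * g₂ * y) : ↥(unitaryGroupOfForm (galAdicCompletionMap (L := L) (IsCMField.complexConj L) hw) (placeForm (Matrix.of fun i j : Fin 2 => if i.val + j.val + 1 = 2 then (1 : L) else 0) w.1))) : GL (Fin 2) (w.1.adicCompletion L)) = (k : GL (Fin 2) (w.1.adicCompletion L)) := by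
      intro y' k hk
      have hy'U : (y' : GL (Fin 2) (w.1.adicCompletion L)) ∈ (unitaryGroupOfForm (galAdicCompletionMap (L := L) (IsCMField.complexConj L) hw) (placeForm (Matrix.of fun i j : Fin 2 => if i.val + j.val + 1 = 2 then (1 : L) else 0) w.1)) := by rw [← hUG]; exact y'.2
      have hkv : (k : GL (Fin 2) (w.1.adicCompletion L)) = (y' : GL (Fin 2) (w.1.adicCompletion L))⁻¹ * (γ' : GL (Fin 2) (w.1.adicCompletion L)) * (y' : GL (Fin 2) (w.1.adicCompletion L)) := by
        rw [hk, Subgroup.coe_mul, Subgroup.coe_mul, Subgroup.coe_inv]; group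
      refine ⟨E₂.symm ⟨(y' : GL (Fin 2) (w.1.adicCompletion L)), hy'U⟩, ?_⟩
      rw [map_mul, map_mul, map_inv, ContinuousMulEquiv.apply_symm_apply, Subgroup.coe_mul, Subgroup.coe_mul, Subgroup.coe_inv, hkv, hγ']
    rcases key with ⟨y', k, hk, hγk⟩ | ⟨y', k, hk, hγk⟩
    · obtain ⟨y, hy⟩ := transport y' k hγk
      refine ⟨0, y, ?_⟩
      simp only [Matrix.cons_val_zero]
      refine (mem_localIntegralLevel_iff_of_smul_eq (IsCMField.complexConj L) 2 (Matrix.of fun i j : Fin 2 => if i.val + j.val + 1 = 2 then (1 : L) else 0) (IsCMField.complexConj_ne_one L) w hw (y⁻¹ * g₂ * y)).2 ?_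
      rw [← hE₂, hy]
      exact Subgroup.mem_subgroupOf.1 hk
    · obtain ⟨y, hy⟩ := transport y' k hγk
      refine ⟨1, y, ?_⟩
      simp only [Matrix.cons_val_one, Matrix.cons_val_zero, Subgroup.mem_comap, Subgroup.mem_subgroupOf]
      have hval : ((E₂.toMulEquiv.toMonoidHom (y⁻¹ * g₂ * y) : ↥(unitaryGroupOfForm (galAdicCompletionMap (L := L) (IsCMField.complexConj L) hw) (placeForm (Matrix.of fun i j : Fin 2 => if i.val + j.val + 1 = 2 then (1 : L) else 0) w.1))) : GL (Fin 2) (w.1.adicCompletion L)) = (k : GL (Fin 2) (w.1.adicCompletion L)) := hy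
      rw [hval]
      exact Subgroup.mem_subgroupOf.1 hk

/-! ## §3 (ED. 2) The same cover at a TAMELY RAMIFIED non-split place: edge stabiliser `K` and vertex stabiliser `K♯` -/

/-- **THE VERTEX∕EDGE COVER AT A TAMELY RAMIFIED PLACE (binder `hcov` of the ramified core assembly R-5b), `cmDatum` currency.**  At `v` non-split with
`e(w|v) ≠ 1`, `|2|_w = 1` and an anti-fixed uniformiser `η` (`σ_w η = −η`, ★ `exists_uniformizer_galAdicCompletionMap_complexConj_eq_neg_of_ramified`) there are two compact
open subgroups `K₂ 0, K₂ 1 ≤ U(Φ₂)(L⁺_v)` — `K₂ 0 = U(Φ₂)(𝒪_v)` (EDGE-midpoint stabiliser; in the one-place model `GL₂(𝒪_w) ∩ U`) and `K₂ 1 = e₂⁻¹(U ∩ D_η GL₂(𝒪_w) D_η⁻¹)`,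
`D_η = diag(1, η)` (VERTEX stabiliser `K♯`) — such that every `g₂` with `v_w(tr g₂) ≤ 1` satisfies `y⁻¹ g₂ y ∈ K₂ ε` for some `ε`, `y`.  Transport of ★ A-p03 (g26)
`exists_eq_mul_mul_inv_or_of_trace_mem_of_ramified` along ★ `localNonsplitEquiv`, verbatim as in §2.
[cite: Serre1980Trees, Ch. II §1.3] [cite: Kottwitz1988, §2] [cite: Rogawski1990, §4.9 Lemma 4.9.3 p. 56] [cite: PlatonovRapinchuk1994, §5.1] -/
theorem exists_vertexCover_of_ramified (he : v.asIdeal.ramificationIdx' w.1.asIdeal ≠ 1) (h2 : Valued.v (2 : w.1.adicCompletion L) = 1)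
    (η : (w.1.adicCompletion L)ˣ) (hη : Valued.v (η : w.1.adicCompletion L) = WithZero.exp (-1 : ℤ))
    (hση : galAdicCompletionMap (L := L) (IsCMField.complexConj L) hw (η : w.1.adicCompletion L) = -(η : w.1.adicCompletion L)) :
    ∃ K₂ : Fin 2 → Subgroup ((cmDatum L 2 (Matrix.of fun i j : Fin 2 => if i.val + j.val + 1 = 2 then (1 : L) else 0)).Local v),
      K₂ 0 = cmLocalIntegralLevel L 2 (Matrix.of fun i j : Fin 2 => if i.val + j.val + 1 = 2 then (1 : L) else 0) v ∧
      (∀ g, g ∈ K₂ 0 ↔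
        (((localNonsplitEquiv (IsCMField.complexConj L) (Matrix.of fun i j : Fin 2 => if i.val + j.val + 1 = 2 then (1 : L) else 0) (IsCMField.complexConj_ne_one L) w hw) g : ↥(unitaryGroupOfForm (galAdicCompletionMap (L := L) (IsCMField.complexConj L) hw) (placeForm (Matrix.of fun i j : Fin 2 => if i.val + j.val + 1 = 2 then (1 : L) else 0) w.1))) : GL (Fin 2) (w.1.adicCompletion L)) ∈ glInt 2 (w.1.adicCompletion L)) ∧
      (∀ g, g ∈ K₂ 1 ↔
        (((localNonsplitEquiv (IsCMField.complexConj L) (Matrix.of fun i j : Fin 2 => if i.val + j.val + 1 = 2 then (1 : L) else 0) (IsCMField.complexConj_ne_one L) w hw) g : ↥(unitaryGroupOfForm (galAdicCompletionMap (L := L) (IsCMField.complexConj L) hw) (placeForm (Matrix.of fun i j : Fin 2 => if i.val + j.val + 1 = 2 then (1 : L) else 0) w.1))) : GL (Fin 2) (w.1.adicCompletion L)) ∈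
          (glInt 2 (w.1.adicCompletion L)).map (MulAut.conj (glDiagonal 2 (w.1.adicCompletion L) ![1, η])).toMonoidHom) ∧
      (∀ ε, IsOpen (K₂ ε : Set ((cmDatum L 2 (Matrix.of fun i j : Fin 2 => if i.val + j.val + 1 = 2 then (1 : L) else 0)).Local v))) ∧
      (∀ ε, IsCompact (K₂ ε : Set ((cmDatum L 2 (Matrix.of fun i j : Fin 2 => if i.val + j.val + 1 = 2 then (1 : L) else 0)).Local v))) ∧
      ∀ g₂ : (cmDatum L 2 (Matrix.of fun i j : Fin 2 => if i.val + j.val + 1 = 2 then (1 : L) else 0)).Local v,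
        Valued.v (((g₂.val.val : Matrix (Fin 2) (Fin 2) (LocalRing L v)).trace) w) ≤ 1 →
          ∃ (ε : Fin 2) (y : (cmDatum L 2 (Matrix.of fun i j : Fin 2 => if i.val + j.val + 1 = 2 then (1 : L) else 0)).Local v), y⁻¹ * g₂ * y ∈ K₂ ε := by
  -- the one-place model, re-typed on the `cmDatum` carrier (as in §2)
  obtain ⟨E₂, hE₂⟩ : ∃ E₂ : (cmDatum L 2 (Matrix.of fun i j : Fin 2 => if i.val + j.val + 1 = 2 then (1 : L) else 0)).Local v ≃ₜ* ↥(unitaryGroupOfForm (galAdicCompletionMap (L := L) (IsCMField.complexConj L) hw) (placeForm (Matrix.of fun i j : Fin 2 => if i.val + j.val + 1 = 2 then (1 : L) else 0) w.1)),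
      ∀ g, ((E₂ g : ↥(unitaryGroupOfForm (galAdicCompletionMap (L := L) (IsCMField.complexConj L) hw) (placeForm (Matrix.of fun i j : Fin 2 => if i.val + j.val + 1 = 2 then (1 : L) else 0) w.1))) : GL (Fin 2) (w.1.adicCompletion L)) = (((localNonsplitEquiv (IsCMField.complexConj L) (Matrix.of fun i j : Fin 2 => if i.val + j.val + 1 = 2 then (1 : L) else 0) (IsCMField.complexConj_ne_one L) w hw) g : ↥(unitaryGroupOfForm (galAdicCompletionMap (L := L) (IsCMField.complexConj L) hw) (placeForm (Matrix.of fun i j : Fin 2 => if i.val + j.val + 1 = 2 then (1 : L) else 0) w.1))) : GL (Fin 2) (w.1.adicCompletion L)) :=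
    ⟨(localNonsplitEquiv (IsCMField.complexConj L) (Matrix.of fun i j : Fin 2 => if i.val + j.val + 1 = 2 then (1 : L) else 0) (IsCMField.complexConj_ne_one L) w hw), fun _ => rfl⟩
  have hUG : Literature.AlgebraicGeometry.ShimuraVarieties.unitaryGroup (galAdicCompletionMap (L := L) (IsCMField.complexConj L) hw) (placeForm (Matrix.of fun i j : Fin 2 => if i.val + j.val + 1 = 2 then (1 : L) else 0) w.1) = (unitaryGroupOfForm (galAdicCompletionMap (L := L) (IsCMField.complexConj L) hw) (placeForm (Matrix.of fun i j : Fin 2 => if i.val + j.val + 1 = 2 then (1 : L) else 0) w.1)) :=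
    Literature.AlgebraicGeometry.ShimuraVarieties.unitaryGroup_eq_unitaryGroupOfForm _ _
  have hK1 := isCompact_isOpen_conjGlInt_subgroupOf_unitary L v w hw (placeForm (Matrix.of fun i j : Fin 2 => if i.val + j.val + 1 = 2 then (1 : L) else 0) w.1) (glDiagonal 2 (w.1.adicCompletion L) ![1, η])
  refine ⟨![cmLocalIntegralLevel L 2 (Matrix.of fun i j : Fin 2 => if i.val + j.val + 1 = 2 then (1 : L) else 0) v,
      ((((glInt 2 (w.1.adicCompletion L)).map (MulAut.conj (glDiagonal 2 (w.1.adicCompletion L) ![1, η])).toMonoidHom).subgroupOf (unitaryGroupOfForm (galAdicCompletionMap (L := L) (IsCMField.complexConj L) hw) (placeForm (Matrix.of fun i j : Fin 2 => if i.val + j.val + 1 = 2 then (1 : L) else 0) w.1))).comap E₂.toMulEquiv.toMonoidHom)],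
    rfl, fun g => mem_localIntegralLevel_iff_of_smul_eq (IsCMField.complexConj L) 2 (Matrix.of fun i j : Fin 2 => if i.val + j.val + 1 = 2 then (1 : L) else 0) (IsCMField.complexConj_ne_one L) w hw g,
    fun g => ?_, fun ε => ?_, fun ε => ?_, fun g₂ hg₂ => ?_⟩
  · simp only [Matrix.cons_val_one, Matrix.cons_val_zero, Subgroup.mem_comap, Subgroup.mem_subgroupOf]
    rw [← hE₂ g]; rfl
  · fin_cases ε
    · exact (isCompact_isOpen_cmLocalIntegralLevel L 2 (Matrix.of fun i j : Fin 2 => if i.val + j.val + 1 = 2 then (1 : L) else 0) v).2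
    · exact Literature.GroupTheory.isOpen_coe_comap_of_continuous E₂.toMulEquiv.toMonoidHom E₂.continuous _ hK1.2
  · fin_cases ε
    · exact (isCompact_isOpen_cmLocalIntegralLevel L 2 (Matrix.of fun i j : Fin 2 => if i.val + j.val + 1 = 2 then (1 : L) else 0) v).1
    · exact Literature.GroupTheory.isCompact_coe_comap_continuousMulEquiv E₂ _ hK1.1
  · have htr : ((((E₂ g₂ : ↥(unitaryGroupOfForm (galAdicCompletionMap (L := L) (IsCMField.complexConj L) hw) (placeForm (Matrix.of fun i j : Fin 2 => if i.val + j.val + 1 = 2 then (1 : L) else 0) w.1))) : GL (Fin 2) (w.1.adicCompletion L)) : Matrix (Fin 2) (Fin 2) (w.1.adicCompletion L))).trace ∈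
        (ValuativeRel.valuation (w.1.adicCompletion L)).integer := by
      rw [Valuation.mem_integer_iff, SemiLocal.valuation_le_one_iff_valued_le_one, hE₂, trace_coe_localNonsplitEquiv L v w hw _ g₂]
      exact hg₂
    obtain ⟨γ', hγ'⟩ : ∃ γ' : ↥(Literature.AlgebraicGeometry.ShimuraVarieties.unitaryGroup (galAdicCompletionMap (L := L) (IsCMField.complexConj L) hw) (placeForm (Matrix.of fun i j : Fin 2 => if i.val + j.val + 1 = 2 then (1 : L) else 0) w.1)),
        (γ' : GL (Fin 2) (w.1.adicCompletion L)) = ((E₂ g₂ : ↥(unitaryGroupOfForm (galAdicCompletionMap (L := L) (IsCMField.complexConj L) hw) (placeForm (Matrix.of fun i j : Fin 2 => if i.val + j.val + 1 = 2 then (1 : L) else 0) w.1))) : GL (Fin 2) (w.1.adicCompletion L)) :=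
      ⟨⟨((E₂ g₂ : ↥(unitaryGroupOfForm (galAdicCompletionMap (L := L) (IsCMField.complexConj L) hw) (placeForm (Matrix.of fun i j : Fin 2 => if i.val + j.val + 1 = 2 then (1 : L) else 0) w.1))) : GL (Fin 2) (w.1.adicCompletion L)), by rw [hUG]; exact (E₂ g₂).2⟩, rfl⟩
    have key := exists_eq_mul_mul_inv_or_of_trace_mem_of_ramified L v w hw he h2 η hη hση γ' (by rw [hγ']; exact htr)
    have transport : ∀ (y' k : ↥(Literature.AlgebraicGeometry.ShimuraVarieties.unitaryGroup (galAdicCompletionMap (L := L) (IsCMField.complexConj L) hw) (placeForm (Matrix.of fun i j : Fin 2 => if i.val + j.val + 1 = 2 then (1 : L) else 0) w.1))),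
        γ' = y' * k * y'⁻¹ → ∃ y : (cmDatum L 2 (Matrix.of fun i j : Fin 2 => if i.val + j.val + 1 = 2 then (1 : L) else 0)).Local v, ((E₂ (y⁻¹ * g₂ * y) : ↥(unitaryGroupOfForm (galAdicCompletionMap (L := L) (IsCMField.complexConj L) hw) (placeForm (Matrix.of fun i j : Fin 2 => if i.val + j.val + 1 = 2 then (1 : L) else 0) w.1))) : GL (Fin 2) (w.1.adicCompletion L)) = (k : GL (Fin 2) (w.1.adicCompletion L)) := by
      intro y' k hk
      have hy'U : (y' : GL (Fin 2) (w.1.adicCompletion L)) ∈ (unitaryGroupOfForm (galAdicCompletionMap (L := L) (IsCMField.complexConj L) hw) (placeForm (Matrix.of fun i j : Fin 2 => if i.val + j.val + 1 = 2 then (1 : L) else 0) w.1)) := by rw [← hUG]; exact y'.2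
      have hkv : (k : GL (Fin 2) (w.1.adicCompletion L)) = (y' : GL (Fin 2) (w.1.adicCompletion L))⁻¹ * (γ' : GL (Fin 2) (w.1.adicCompletion L)) * (y' : GL (Fin 2) (w.1.adicCompletion L)) := by
        rw [hk, Subgroup.coe_mul, Subgroup.coe_mul, Subgroup.coe_inv]; group
      refine ⟨E₂.symm ⟨(y' : GL (Fin 2) (w.1.adicCompletion L)), hy'U⟩, ?_⟩
      rw [map_mul, map_mul, map_inv, ContinuousMulEquiv.apply_symm_apply, Subgroup.coe_mul, Subgroup.coe_mul, Subgroup.coe_inv, hkv, hγ']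
    rcases key with ⟨y', k, hk, hγk⟩ | ⟨y', k, hk, hγk⟩
    · obtain ⟨y, hy⟩ := transport y' k hγk
      refine ⟨0, y, ?_⟩
      simp only [Matrix.cons_val_zero]
      refine (mem_localIntegralLevel_iff_of_smul_eq (IsCMField.complexConj L) 2 (Matrix.of fun i j : Fin 2 => if i.val + j.val + 1 = 2 then (1 : L) else 0) (IsCMField.complexConj_ne_one L) w hw (y⁻¹ * g₂ * y)).2 ?_
      rw [← hE₂, hy]
      exact Subgroup.mem_subgroupOf.1 hk
    · obtain ⟨y, hy⟩ := transport y' k hγk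
      refine ⟨1, y, ?_⟩
      simp only [Matrix.cons_val_one, Matrix.cons_val_zero, Subgroup.mem_comap, Subgroup.mem_subgroupOf]
      have hval : ((E₂.toMulEquiv.toMonoidHom (y⁻¹ * g₂ * y) : ↥(unitaryGroupOfForm (galAdicCompletionMap (L := L) (IsCMField.complexConj L) hw) (placeForm (Matrix.of fun i j : Fin 2 => if i.val + j.val + 1 = 2 then (1 : L) else 0) w.1))) : GL (Fin 2) (w.1.adicCompletion L)) = (k : GL (Fin 2) (w.1.adicCompletion L)) := hy
      rw [hval]
      exact Subgroup.mem_subgroupOf.1 hk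


end Literature.NumberTheory.Rogawski1990

end
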